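import Literature.Computability.AlgebraicComplexity.GroupTheoreticMatMul
import Mathlib.GroupTheory.Exponent
import Mathlib.Algebra.Group.Subgroup.ZPowers.Basic
import Mathlib.Data.ZMod.Basic
import Mathlib.GroupTheory.SpecificGroups.Cyclic
import Mathlib.Tactic.Abel

/-!
# ω-census tool law: no TPP triple of 2-sets inside a cyclic group of order ≤ 7 — the DOUBLING-CHAIN class needs `ord d ≥ 8`

HONEST FRAMING (pub-omega census; verbatim): lottery ticket; floor = certified bounds/negative ranges.
Census STRUCTURE bookkeeping (STRUCTURE.md N21, the doubling-chain law of the `(2,2,2)⁶` hosts, and its corollary used in prereg P-041 for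
the `N₆`-exactness cell `ℤ₅³`), nothing about `ω`.

THE NULL WITH ITS ONE-LINE WHY.  A TPP triple of 2-subsets `{p, p+α}, {q, q+β}, {r, r+γ}` of an abelian group (first clause of CKSU 2005
Def. 5.1, tree one-clause form) needs every signed combination `±α ± β ± γ`, `±α ± β`, …, `±α` to be non-zero.  If `α, β, γ` are multiples
of one element `g` with `n • g = 0`, `1 ≤ n ≤ 7`, this is impossible: the non-zero residues modulo `n ≤ 7` form at most three classes
`{±1}, {±2}, {±3}` up to sign; two of `α, β, γ` in one class give `α ∓ β = 0`, three different classes give `1 + 2 − 3 ≡ 0` (or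
`1 + 2 + 3 ≡ 0 (mod 6)`) — a 441-case residue check done once by `decide` (`signedResidues_le_seven`) and lifted to the group
(`not_tpp_pairs_of_nsmul_eq_zero`).  Consequences:
* `not_isSTPP_of_zmultiples` — an STPP family of 2-sets is impossible as soon as ONE of its triples has its three within-set differences among
  the multiples of such a `g`;
* `not_isSTPP_of_chain` — the DOUBLING-CHAIN class of STRUCTURE N21 (within-set differences in `{±d, ±2d, ±4d}` for one `d`; the tight
  `(2,2,2)⁶` witnesses reported there — ℤ/117, ℤ/125, ℤ/127, ℤ/131, ℤ/137, ℤ₅×ℤ₂₅, and ℤ₂×ℤ₆₁ of `STPP222Pow6SeedsO` — are of this kind) is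
  EMPTY — already one chain triple is impossible — whenever `n • d = 0` with `1 ≤ n ≤ 7`, hence in every group of exponent `1 ≤ e ≤ 7`
  (`not_isSTPP_of_chain_of_exponent_le_seven`), in particular in `ℤ₅³` (`not_isSTPP_of_chain_zmod5_cube`: the structural reason, recorded in
  P-041, why the chain mechanism is unavailable in the `N₆ = 125` cell);
* the threshold is SHARP: `{0,1}, {0,2}, {0,4} ⊆ ℤ/8` is a TPP triple (`tpp_chain_zmod8`, 64-case `decide`); for `ord d ≥ 8` the chain
  `{d, 2d, 4d}` always is one since `0 < |±1 ± 2 ± 4| ≤ 7`.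
References: H. Cohn, R. Kleinberg, B. Szegedy, C. Umans, FOCS 2005 (arXiv:math/0511460), Def. 5.1.  Seat pub-omega-kernel-l4 (gen 19), 2026-08-27.
-/

namespace Summit.MatrixMultiplication.OmegaCensus

open Finset Literature.Computability.AlgebraicComplexity

namespace ShortCyclic

/-- **The residue check (441 cases, `decide`).** For `1 ≤ n ≤ 7` and non-zero residues `a, b, c (mod n)` some non-trivial signed combination
of them vanishes modulo `n`; signs are encoded by multipliers `0 ↦ 0`, `+1 ↦ 1`, `−1 ↦ n − 1`. [folklore] -/
theorem signedResidues_le_seven :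
    ∀ n ∈ Finset.Icc 1 7, ∀ a ∈ Finset.range n, ∀ b ∈ Finset.range n, ∀ c ∈ Finset.range n, a ≠ 0 → b ≠ 0 → c ≠ 0 →
      ∃ x ∈ [0, 1, n - 1], ∃ y ∈ [0, 1, n - 1], ∃ z ∈ [0, 1, n - 1], (x, y, z) ≠ (0, 0, 0) ∧ (x * a + y * b + z * c) % n = 0 := by
  decide

variable {G : Type*} [AddCommGroup G]

/-- A `ℤ`-multiple of `g` is an `ℕ`-multiple below `n` once `n • g = 0`, `0 < n`. [folklore] -/
theorem exists_nsmul_lt_of_mem_zmultiples {g α : G} {n : ℕ} (hn : 0 < n) (hg : n • g = 0)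
    (hα : α ∈ AddSubgroup.zmultiples g) : ∃ a : ℕ, a < n ∧ a • g = α := by
  obtain ⟨k, rfl⟩ := AddSubgroup.mem_zmultiples_iff.1 hα
  have hn' : (0 : ℤ) < n := by exact_mod_cast hn
  have h0 : (0 : ℤ) ≤ k % n := Int.emod_nonneg _ hn'.ne'
  refine ⟨(k % n).toNat, ?_, ?_⟩
  · have := Int.emod_lt_of_pos k hn'
    omega
  · have hz : (((n : ℤ) * (k / n)) : ℤ) • g = 0 := by
      rw [mul_comm, ← smul_smul, natCast_zsmul, hg, smul_zero]
    rw [← natCast_zsmul, Int.toNat_of_nonneg h0]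
    conv_rhs => rw [← Int.emod_add_mul_ediv k n]
    rw [add_zsmul, hz, add_zero]

/-- The signed multiple encoded by `x ∈ {0, 1, n−1}`: `(x * a) • g` is `0`, `a • g` or `−(a • g)` (given `n • g = 0`). [folklore] -/
theorem signMul_nsmul {g : G} {n : ℕ} (hg : n • g = 0) {x a : ℕ} (hx : x ∈ [0, 1, n - 1]) :
    (x * a) • g = 0 ∨ (x * a) • g = a • g ∨ (x * a) • g = -(a • g) := by
  simp only [List.mem_cons, List.not_mem_nil, or_false] at hx
  rcases hx with rfl | rfl | rfl
  · exact Or.inl (by simp)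
  · exact Or.inr (Or.inl (by simp))
  · rcases Nat.eq_zero_or_pos n with rfl | hn
    · exact Or.inl (by simp)
    · refine Or.inr (Or.inr ?_)
      rw [eq_neg_iff_add_eq_zero, ← add_nsmul]
      have e : (n - 1) * a + a = a * n := by
        rw [Nat.sub_one_mul, Nat.sub_add_cancel (Nat.le_mul_of_pos_left a hn), mul_comm]
      rw [e, mul_nsmul', hg, nsmul_zero]

/-- In a 2-set `{p, p + α}` one can realise the difference `s' − s ∈ {0, α, −α}` prescribed by a sign. [folklore] -/
theorem exists_pair_sub_eq [DecidableEq G] (p α δ : G) (hδ : δ = 0 ∨ δ = α ∨ δ = -α) :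
    ∃ s ∈ ({p, p + α} : Finset G), ∃ s' ∈ ({p, p + α} : Finset G), s' - s = δ ∧ (δ ≠ 0 → s ≠ s') := by
  rcases hδ with h0 | h1 | h2
  · exact ⟨p, by simp, p, by simp, by rw [h0, sub_self], fun h => (h h0).elim⟩
  · exact ⟨p, by simp, p + α, by simp, by rw [h1]; abel, fun h e => h (by rw [h1]; simpa using e.symm)⟩
  · exact ⟨p + α, by simp, p, by simp, by rw [h2]; abel, fun h e => h (by rw [h2, show α = 0 by simpa using e, neg_zero])⟩

/-- **No TPP triple of 2-sets with differences in a cyclic group of order ≤ 7.**  If `n • g = 0` with `1 ≤ n ≤ 7` and the non-zero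
differences `α, β, γ` of the 2-sets `{p, p+α}, {q, q+β}, {r, r+γ}` are all multiples of `g`, the TPP clause (first clause of CKSU Def. 5.1,
tree one-clause form) fails. [cite: CohnKleinbergSzegedyUmans2005, Def. 5.1] -/
theorem not_tpp_pairs_of_nsmul_eq_zero [DecidableEq G] {g : G} {n : ℕ} (hn : 0 < n) (hn7 : n ≤ 7) (hg : n • g = 0)
    {p q r α β γ : G} (hα : α ∈ AddSubgroup.zmultiples g) (hβ : β ∈ AddSubgroup.zmultiples g)
    (hγ : γ ∈ AddSubgroup.zmultiples g) (hα0 : α ≠ 0) (hβ0 : β ≠ 0) (hγ0 : γ ≠ 0)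
    (hT : ∀ s ∈ ({p, p + α} : Finset G), ∀ s' ∈ ({p, p + α} : Finset G), ∀ t ∈ ({q, q + β} : Finset G),
      ∀ t' ∈ ({q, q + β} : Finset G), ∀ u ∈ ({r, r + γ} : Finset G), ∀ u' ∈ ({r, r + γ} : Finset G),
      (s' - s) + (t' - t) + (u' - u) = 0 → s = s' ∧ t = t' ∧ u = u') : False := by
  obtain ⟨a, ha, rfl⟩ := exists_nsmul_lt_of_mem_zmultiples hn hg hα
  obtain ⟨b, hb, rfl⟩ := exists_nsmul_lt_of_mem_zmultiples hn hg hβ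
  obtain ⟨c, hc, rfl⟩ := exists_nsmul_lt_of_mem_zmultiples hn hg hγ
  have ha0 : a ≠ 0 := by rintro rfl; exact hα0 (zero_nsmul g)
  have hb0 : b ≠ 0 := by rintro rfl; exact hβ0 (zero_nsmul g)
  have hc0 : c ≠ 0 := by rintro rfl; exact hγ0 (zero_nsmul g)
  obtain ⟨x, hx, y, hy, z, hz, hne, hmod⟩ := signedResidues_le_seven n (Finset.mem_Icc.2 ⟨hn, hn7⟩) a (Finset.mem_range.2 ha)
    b (Finset.mem_range.2 hb) c (Finset.mem_range.2 hc) ha0 hb0 hc0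
  -- the total combination vanishes in `G`
  have htot : (x * a) • g + (y * b) • g + (z * c) • g = 0 := by
    rw [← add_nsmul, ← add_nsmul, ← Nat.div_add_mod (x * a + y * b + z * c) n, hmod, add_zero, mul_nsmul, hg, nsmul_zero]
  -- realise the three signed differences inside the 2-sets
  obtain ⟨s, hs, s', hs', hss, hs0⟩ := exists_pair_sub_eq p (a • g) ((x * a) • g) (signMul_nsmul hg hx)
  obtain ⟨t, ht, t', ht', htt, ht0⟩ := exists_pair_sub_eq q (b • g) ((y * b) • g) (signMul_nsmul hg hy)
  obtain ⟨u, hu, u', hu', huu, hu0⟩ := exists_pair_sub_eq r (c • g) ((z * c) • g) (signMul_nsmul hg hz)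
  obtain ⟨h1, h2, h3⟩ := hT s hs s' hs' t ht t' ht' u hu u' hu' (by rw [hss, htt, huu, htot])
  -- some sign is non-zero, and a non-zero signed multiple of a non-zero difference is non-zero
  have key : ∀ {w m : ℕ}, w ∈ [0, 1, n - 1] → m • g ≠ 0 → (w * m) • g = 0 → w = 0 := by
    intro w m hw hmg h0
    simp only [List.mem_cons, List.not_mem_nil, or_false] at hw
    rcases hw with rfl | rfl | rfl
    · rfl
    · exact absurd (by simpa using h0) hmg
    · rcases Nat.eq_zero_or_pos (n - 1) with h01 | -
      · exact h01
      · exfalso; apply hmg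
        have e2 : ((n - 1) * m + m) • g = 0 := by
          rw [Nat.sub_one_mul, Nat.sub_add_cancel (Nat.le_mul_of_pos_left m hn), mul_comm, mul_nsmul', hg, nsmul_zero]
        rwa [add_nsmul, h0, zero_add] at e2
  apply hne
  have ex : x = 0 := key hx hα0 (by by_contra h0; exact hs0 h0 h1)
  have ey : y = 0 := key hy hβ0 (by by_contra h0; exact ht0 h0 h2)
  have ez : z = 0 := key hz hγ0 (by by_contra h0; exact hu0 h0 h3)
  rw [ex, ey, ez]

/-! ## Families: one short-cyclic triple kills an STPP family; the doubling-chain class -/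

/-- A 2-set `{p, p + α}` of cardinality two has `α ≠ 0`. [folklore] -/
theorem ne_zero_of_card_pair [DecidableEq G] {p α : G} (h : ({p, p + α} : Finset G).card = 2) : α ≠ 0 := by
  rintro rfl
  simp at h

/-- **One triple with short-cyclic differences kills the family.**  If some triple `t` of a family consists of 2-sets
`{p, p+α}, {q, q+β}, {r, r+γ}` whose non-zero differences are multiples of one `g` with `n • g = 0`, `1 ≤ n ≤ 7`, the family is not STPP
(CKSU Def. 5.1 fails already in its TPP clause at `i = j = k = t`). [cite: CohnKleinbergSzegedyUmans2005, Def. 5.1] -/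
theorem not_isSTPP_of_zmultiples [DecidableEq G] {K : ℕ} {A B C : Fin K → Finset G} {g : G} {n : ℕ}
    (hn : 0 < n) (hn7 : n ≤ 7) (hg : n • g = 0) (t : Fin K) {p q r α β γ : G}
    (hA : A t = {p, p + α}) (hB : B t = {q, q + β}) (hC : C t = {r, r + γ})
    (hα : α ∈ AddSubgroup.zmultiples g) (hβ : β ∈ AddSubgroup.zmultiples g) (hγ : γ ∈ AddSubgroup.zmultiples g)
    (hα0 : α ≠ 0) (hβ0 : β ≠ 0) (hγ0 : γ ≠ 0) : ¬ IsSTPP A B C := by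
  intro hS
  refine not_tpp_pairs_of_nsmul_eq_zero hn hn7 hg hα hβ hγ hα0 hβ0 hγ0 (p := p) (q := q) (r := r) ?_
  intro s hs s' hs' v hv v' hv' u hu u' hu' h0
  rw [← hA] at hs hs'
  rw [← hB] at hv hv'
  rw [← hC] at hu hu'
  obtain ⟨-, -, h1, h2, h3⟩ := hS t t t s hs s' hs' v hv v' hv' u hu u' hu' h0
  exact ⟨h1, h2, h3⟩

/-- The same with the order of `g`: differences in `ℤ • g` with `1 ≤ addOrderOf g ≤ 7` are impossible. [cite: CohnKleinbergSzegedyUmans2005, Def. 5.1] -/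
theorem not_isSTPP_of_zmultiples_addOrderOf [DecidableEq G] {K : ℕ} {A B C : Fin K → Finset G} {g : G}
    (h1 : 0 < addOrderOf g) (h7 : addOrderOf g ≤ 7) (t : Fin K) {p q r α β γ : G}
    (hA : A t = {p, p + α}) (hB : B t = {q, q + β}) (hC : C t = {r, r + γ})
    (hα : α ∈ AddSubgroup.zmultiples g) (hβ : β ∈ AddSubgroup.zmultiples g) (hγ : γ ∈ AddSubgroup.zmultiples g)
    (hα0 : α ≠ 0) (hβ0 : β ≠ 0) (hγ0 : γ ≠ 0) : ¬ IsSTPP A B C :=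
  not_isSTPP_of_zmultiples h1 h7 (addOrderOf_nsmul_eq_zero g) t hA hB hC hα hβ hγ hα0 hβ0 hγ0

/-- Every DOUBLING-CHAIN difference `±d, ±2d, ±4d` (STRUCTURE N21) is a multiple of `d`. [folklore] -/
theorem mem_zmultiples_of_mem_chain [DecidableEq G] {d δ : G} (h : δ ∈ ({d, -d, 2 • d, -(2 • d), 4 • d, -(4 • d)} : Finset G)) :
    δ ∈ AddSubgroup.zmultiples d := by
  simp only [Finset.mem_insert, Finset.mem_singleton] at h
  rcases h with h | h | h | h | h | h <;> rw [h]
  exacts [AddSubgroup.mem_zmultiples d, neg_mem (AddSubgroup.mem_zmultiples d), AddSubgroup.nsmul_mem_zmultiples d 2,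
    neg_mem (AddSubgroup.nsmul_mem_zmultiples d 2), AddSubgroup.nsmul_mem_zmultiples d 4,
    neg_mem (AddSubgroup.nsmul_mem_zmultiples d 4)]

/-- **The doubling-chain class is empty for `ord d ≤ 7`.**  If ONE triple of a family is made of 2-sets with differences in the doubling
chain of some `d` with `n • d = 0`, `1 ≤ n ≤ 7`, the family is not STPP. [cite: CohnKleinbergSzegedyUmans2005, Def. 5.1] -/
theorem not_isSTPP_of_chain [DecidableEq G] {K : ℕ} {A B C : Fin K → Finset G} {d : G} {n : ℕ}
    (hn : 0 < n) (hn7 : n ≤ 7) (hd : n • d = 0) (t : Fin K) {p q r α β γ : G}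
    (hA : A t = {p, p + α}) (hB : B t = {q, q + β}) (hC : C t = {r, r + γ})
    (hα : α ∈ ({d, -d, 2 • d, -(2 • d), 4 • d, -(4 • d)} : Finset G))
    (hβ : β ∈ ({d, -d, 2 • d, -(2 • d), 4 • d, -(4 • d)} : Finset G)) (hγ : γ ∈ ({d, -d, 2 • d, -(2 • d), 4 • d, -(4 • d)} : Finset G)) (hα0 : α ≠ 0) (hβ0 : β ≠ 0) (hγ0 : γ ≠ 0) :
    ¬ IsSTPP A B C :=
  not_isSTPP_of_zmultiples hn hn7 hd t hA hB hC (mem_zmultiples_of_mem_chain hα) (mem_zmultiples_of_mem_chain hβ)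
    (mem_zmultiples_of_mem_chain hγ) hα0 hβ0 hγ0

/-- **Exponent form.**  In a group of exponent `1 ≤ e ≤ 7` no STPP family of 2-sets has a doubling-chain triple, for any `d`.
[cite: CohnKleinbergSzegedyUmans2005, Def. 5.1] -/
theorem not_isSTPP_of_chain_of_exponent_le_seven [DecidableEq G] (he0 : AddMonoid.exponent G ≠ 0) (he7 : AddMonoid.exponent G ≤ 7)
    {K : ℕ} {A B C : Fin K → Finset G} {d : G} (t : Fin K) {p q r α β γ : G}
    (hA : A t = {p, p + α}) (hB : B t = {q, q + β}) (hC : C t = {r, r + γ})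
    (hα : α ∈ ({d, -d, 2 • d, -(2 • d), 4 • d, -(4 • d)} : Finset G))
    (hβ : β ∈ ({d, -d, 2 • d, -(2 • d), 4 • d, -(4 • d)} : Finset G)) (hγ : γ ∈ ({d, -d, 2 • d, -(2 • d), 4 • d, -(4 • d)} : Finset G)) (hα0 : α ≠ 0) (hβ0 : β ≠ 0) (hγ0 : γ ≠ 0) :
    ¬ IsSTPP A B C :=
  not_isSTPP_of_chain (Nat.pos_of_ne_zero he0) he7 (AddMonoid.exponent_nsmul_eq_zero d) t hA hB hC hα hβ hγ hα0 hβ0 hγ0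

/-- **The `ℤ₅³` cell of P-041.**  In `ℤ/5 × ℤ/5 × ℤ/5` (exponent 5) no STPP family of 2-sets contains a doubling-chain triple: the chain
mechanism of STRUCTURE N21 is unavailable in the `N₆ = 125` exactness cell. [cite: CohnKleinbergSzegedyUmans2005, Def. 5.1] -/
theorem not_isSTPP_of_chain_zmod5_cube {K : ℕ} {A B C : Fin K → Finset (ZMod 5 × ZMod 5 × ZMod 5)} {d : ZMod 5 × ZMod 5 × ZMod 5}
    (t : Fin K) {p q r α β γ : ZMod 5 × ZMod 5 × ZMod 5}
    (hA : A t = {p, p + α}) (hB : B t = {q, q + β}) (hC : C t = {r, r + γ})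
    (hα : α ∈ ({d, -d, 2 • d, -(2 • d), 4 • d, -(4 • d)} : Finset (ZMod 5 × ZMod 5 × ZMod 5)))
    (hβ : β ∈ ({d, -d, 2 • d, -(2 • d), 4 • d, -(4 • d)} : Finset (ZMod 5 × ZMod 5 × ZMod 5)))
    (hγ : γ ∈ ({d, -d, 2 • d, -(2 • d), 4 • d, -(4 • d)} : Finset (ZMod 5 × ZMod 5 × ZMod 5))) (hα0 : α ≠ 0) (hβ0 : β ≠ 0) (hγ0 : γ ≠ 0) :
    ¬ IsSTPP A B C :=
  have he : AddMonoid.exponent (ZMod 5 × ZMod 5 × ZMod 5) = 5 := by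
    simp [AddMonoid.exponent_prod, ZMod.exponent]
  have h5 : 5 • d = 0 := by simpa [he] using AddMonoid.exponent_nsmul_eq_zero d
  not_isSTPP_of_chain (n := 5) (by norm_num) (by norm_num) h5 t hA hB hC hα hβ hγ hα0 hβ0 hγ0

/-- **Sharpness at order 8.**  The doubling chain itself, `{0,1}, {0,2}, {0,4} ⊆ ℤ/8`, satisfies the TPP clause (`1 + 2 + 4 = 7 < 8`):
the bound `7` in `not_tpp_pairs_of_nsmul_eq_zero` cannot be raised. [cite: CohnKleinbergSzegedyUmans2005, Def. 5.1] -/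
theorem tpp_chain_zmod8 :
    ∀ s ∈ ({0, 1} : Finset (ZMod 8)), ∀ s' ∈ ({0, 1} : Finset (ZMod 8)), ∀ t ∈ ({0, 2} : Finset (ZMod 8)),
      ∀ t' ∈ ({0, 2} : Finset (ZMod 8)), ∀ u ∈ ({0, 4} : Finset (ZMod 8)), ∀ u' ∈ ({0, 4} : Finset (ZMod 8)),
      (s' - s) + (t' - t) + (u' - u) = 0 → s = s' ∧ t = t' ∧ u = u' := by
  decide

end ShortCyclic

end Summit.MatrixMultiplication.OmegaCensus
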